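import Summits.CriticalPhenomena.PercolationContinuityZ3.Theorems.PercNearOneGluingNoHeavyPcintMemCertSym
import Summits.CriticalPhenomena.PercolationContinuityZ3.Theorems.PercNearOneGluingNoHeavyPcintMemAutomatonExact
import HarnessLib

/-!
# CriticalPhenomena/PercolationContinuityZ3 — Theorems/PercNearOneGluingNoHeavyPcintMemCertLow.lean: LOWER certificates modulo symmetry — `num/den ≤ μ_τ(ℤ^d)` from a sub-eigenvector on the canonical rows

Lane prim-pcint, infrastructure (companion of …PcintMemCertSym).  The tree's certificates modulo symmetry (`SCertOK`,
`cnt_bound_of_scertOK`) bound the memory-`τ` counts from ABOVE (`μ_τ ≤ num/den`, hence `p_c ≥ den/num`).  With the exactness of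
the dangerous-set automaton and the dual Collatz–Wielandt bound of …PcintMemAutomatonExact, the SAME row format certifies
LOWER bounds: `SCertLowOK τ num den M L` asks, row by row, `num·V_i ≤ den·Σ_a V(succ)` and `V_i ≤ M` (plus the structural
checks of `SCertOK`: row `0` is `∅`, every successor is `mstep` up to the recorded symmetry), and gives
`numⁿ·V_0 ≤ M·denⁿ·cnt(∅, n) = M·denⁿ·c_{n,τ}` (`cnt_lower_of_scertLowOK`), hence **`le_memGrowth_of_scertLowOK`:
`num/den ≤ μ_τ(ℤ^d)`**.  Two-sided kernel intervals for the memory growth constants (the STRUCTURE programme's rung costs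
`Δ_τ = ln(μ_{τ−2}/μ_τ)` to certified digits) follow by pairing with `SCertOK`; first instance: …PcintMemCertZ3T6
(`μ_6(ℤ³) ∈ [4.8074093, 4.8074125]`).

HONEST FRAMING: bookkeeping; no certificate is run here.  Written by prim-pcint-2 gen 17 (prover-prim-pcint-2-g17-0), 2026-08-25.
-/

namespace Summit.CriticalPhenomena.PercolationContinuityZ3.Theorems.Pcint

open Literature.Probability.Percolation Literature.Probability.LatticeModels

variable {d : ℕ}

/-- **Validity of a LOWER certificate modulo symmetry**: the structural checks of `SCertOK`, the sub-eigenvector inequalities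
`num · V_i ≤ den · Σ_a V(succ_a(i))`, the cap `V_i ≤ M`, and `1 ≤ V_0`.  Decidable. [folklore] -/
def SCertLowOK (τ num den M : ℕ) (L : List (SCertRow d)) : Prop :=
  0 < L.length ∧ sstOf L 0 = ∅ ∧ 1 ≤ svOf L 0 ∧
    ∀ i < L.length,
      (∀ a : Fin d × Bool,
        mstep τ (sstOf L i) a = (ssucc L i a).map (fun p => smulState p.2 (sstOf L p.1)) ∧
        ∀ p ∈ ssucc L i a, p.1 < L.length) ∧
      num * svOf L i ≤ den * srowSum L i ∧ svOf L i ≤ M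

/-- `SCertLowOK` is decidable. [folklore] -/
instance (τ num den M : ℕ) (L : List (SCertRow d)) : Decidable (SCertLowOK τ num den M L) := by
  unfold SCertLowOK; infer_instance

/-- **Soundness of lower certificates modulo symmetry**: `numⁿ · V_0 ≤ M · denⁿ · cnt(∅, n)`. [folklore] -/
theorem cnt_lower_of_scertLowOK {τ num den M : ℕ} {L : List (SCertRow d)} (h : SCertLowOK τ num den M L) :
    ∀ n : ℕ, num ^ n * svOf L 0 ≤ M * den ^ n * cnt (mstep τ) (∅ : MState d) n := by
  obtain ⟨h0, hst0, -, hrows⟩ := h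
  set R : Set ℕ := {i | i < L.length} with hRdef
  have hR : ∀ i ∈ R, ∀ a j, sistep L i a = some j → j ∈ R := by
    intro i hi a j hij
    unfold sistep at hij
    cases hs : ssucc L i a with
    | none => rw [hs] at hij; exact absurd hij (by simp)
    | some p =>
      rw [hs, Option.map_some] at hij
      have hp := ((hrows i hi).1 a).2 p (by rw [hs]; rfl)
      simp only [Option.some.injEq] at hij
      rw [← hij]; exact hp
  have hnone : ∀ i ∈ R, ∀ a, sistep L i a = none → mstep τ (sstOf L i) a = none := by
    intro i hi a hia
    have he := ((hrows i hi).1 a).1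
    unfold sistep at hia
    cases hs : ssucc L i a with
    | none => rw [hs, Option.map_none] at he; exact he
    | some p => rw [hs] at hia; exact absurd hia (by simp)
  have hsome : ∀ i ∈ R, ∀ a j, sistep L i a = some j →
      ∃ T, mstep τ (sstOf L i) a = some T ∧ ∀ n, cnt (mstep τ) T n = cnt (mstep τ) (sstOf L j) n := by
    intro i hi a j hij
    have he := ((hrows i hi).1 a).1
    unfold sistep at hij
    cases hs : ssucc L i a with
    | none => rw [hs] at hij; exact absurd hij (by simp)
    | some p =>
      rw [hs, Option.map_some] at he hij
      simp only [Option.some.injEq] at hij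
      subst hij
      exact ⟨_, he, fun n => cnt_smulState τ p.2 n (sstOf L p.1)⟩
  have hV : ∀ i ∈ R, num * svOf L i ≤ den * (∑ a : Fin d × Bool, optVal (svOf L) (sistep L i a)) :=
    fun i hi => (hrows i hi).2.1
  have hM : ∀ i ∈ R, svOf L i ≤ M := fun i hi => (hrows i hi).2.2
  intro n
  have h1 := cnt_eq_of_simulation_upto (mstep τ) (sistep L) (sstOf L) R hR hnone hsome n 0 h0
  rw [hst0] at h1
  rw [h1]
  exact cnt_ge_of_subcertificate (sistep L) R hR (svOf L) num den M hV hM n 0 h0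

/-- **`num/den ≤ μ_τ(ℤ^d)` from a valid lower certificate modulo symmetry** (`τ ≥ 2`, `den > 0`, `d ≥ 1`). [folklore] -/
theorem le_memGrowth_of_scertLowOK [NeZero d] {τ num den M : ℕ} {L : List (SCertRow d)} (hτ : 2 ≤ τ)
    (hden : 0 < den) (h : SCertLowOK τ num den M L) : (num : ℝ) / den ≤ MemoryTail.memGrowth d τ := by
  have hV0 : 1 ≤ svOf L 0 := h.2.2.1
  have hM1 : 1 ≤ M := hV0.trans ((h.2.2.2 0 h.1).2.2)
  have hcert := cnt_lower_of_scertLowOK h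
  rcases Nat.eq_zero_or_pos num with hnum | hnum
  · rw [hnum, Nat.cast_zero, zero_div]; exact MemoryTail.memGrowth_nonneg d τ
  refine le_memGrowth_of_geometric_le (K := M) (ρ := (num : ℝ) / den) (by exact_mod_cast hM1)
    (div_pos (by exact_mod_cast hnum) (by exact_mod_cast hden)) fun n _ => ?_
  have h1 := hcert n
  rw [cnt_mstep_empty_eq_memCount hτ] at h1
  have h' : ((num : ℝ) ^ n * (svOf L 0 : ℕ)) ≤ (M : ℝ) * (den : ℝ) ^ n * (MemoryTail.memCount d τ n : ℝ) := by
    exact_mod_cast h1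
  have hdn : (0 : ℝ) < (den : ℝ) ^ n := pow_pos (by exact_mod_cast hden) n
  have hMr : (0 : ℝ) < M := by exact_mod_cast hM1
  rw [div_pow, div_div, div_le_iff₀ (mul_pos hdn hMr)]
  have hV1 : (1 : ℝ) ≤ (svOf L 0 : ℕ) := by exact_mod_cast hV0
  nlinarith [pow_nonneg (Nat.cast_nonneg (α := ℝ) num) n]

end Summit.CriticalPhenomena.PercolationContinuityZ3.Theorems.Pcint
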